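import Summits.Ventures.Crystal3D.Bulk.SphPolygonCutPerim
import Summits.Ventures.Crystal3D.Bulk.HexLocateChord
import Summits.Ventures.Crystal3D.Bulk.HexPathBound
import Summits.Ventures.Crystal3D.Bulk.HexPathSum
import Summits.Ventures.Crystal3D.Bulk.TwoCapTangents
import Summits.Ventures.Crystal3D.Bulk.SphPolygonCap
import HarnessLib

/-!
# Two rattlers in one convex face force perimeter `≥ 346.45°` — the main metric theorem of (d3)
# «one rattler per p-hexagon» (generic form)

HONEST FRAMING. Part of the venture `Summits/Ventures/Crystal3D` (cell `pub-crystal3d`, phase 2;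
seat typer-bulk-2), generic and configuration-free: a periodic window-convex polygon `w` of unit
vectors of `ℝ³` and two unit vectors `z₁, z₂` in its closed cone, each at spherical distance
`≥ arccos √(83/200)` from every edge SEGMENT, with `⟪z₁, z₂⟫ ≤ 1/2`. Nothing here mentions
GAP(1.26); the census assembly (`CensusRows`, D ≥ 5/4) is `Bulk/GapRattlerInjective.lean`.
Plan `HOME/lean/hexper/README.md`, paper proof `phase2/theory1/HEX-PERIMETER.md` §§1–4.

* **`two_caps_perimeter_bound`** —
  `2·arccos(−17/83) + 2·(√(117/200)·1000/1001)·arccos(−5/83) ≤ polyPerim w n`.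
  Proof: global cap lemma (edge lines at height `s = √(117/200)` over `z₁, z₂`), sixty-degree
  point `y`, tangent normals `n₊, n₋` and tangent points, two clipping steps (`cut_step`),
  `locate_chord` twice, three-way edge splits, and the polar bound on the two back paths
  (`path_bound`); the certified numerics `two_caps_gt` then contradict any perimeter
  `≤ 4π/3 + 2 arccos (5/8)`.
-/

noncomputable section

namespace Summit.Ventures.Crystal3D

open Literature.Geometry.DiscreteGeometry Real InnerProductGeometry Finset
open scoped InnerProductSpace RealInnerProductSpace

set_option maxHeartbeats 400000 in
/-- **Main metric theorem of (d3).** (One long elaboration: measured 100k–140k heartbeats; the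
limit is doubled for margin.) -/
theorem two_caps_perimeter_bound {n : ℕ} {w : ℕ → EuclideanSpace ℝ (Fin 3)} (hn : 3 ≤ n)
    (hper : ∀ i, w (i + n) = w i)
    (hcx : ∀ i j k, i < j → j < k → k < i + n → 0 < orient3 (w i) (w j) (w k))
    {z₁ z₂ : EuclideanSpace ℝ (Fin 3)} (hz₁ : ‖z₁‖ = 1) (hz₂ : ‖z₂‖ = 1)
    (hin₁ : ∀ i, 0 ≤ orient3 (w i) (w (i + 1)) z₁) (hin₂ : ∀ i, 0 ≤ orient3 (w i) (w (i + 1)) z₂)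
    (hseg₁ : ∀ i, ∀ a b : ℝ, 0 ≤ a → 0 ≤ b →
      ⟪z₁, a • w i + b • w (i + 1)⟫ ≤ Real.sqrt (83 / 200) * ‖a • w i + b • w (i + 1)‖)
    (hseg₂ : ∀ i, ∀ a b : ℝ, 0 ≤ a → 0 ≤ b →
      ⟪z₂, a • w i + b • w (i + 1)⟫ ≤ Real.sqrt (83 / 200) * ‖a • w i + b • w (i + 1)‖)
    (h12 : ⟪z₁, z₂⟫ ≤ 1 / 2) :
    2 * arccos (-17 / 83 : ℝ) + 2 * (Real.sqrt (117 / 200) * 1000 / 1001) * arccos (-5 / 83 : ℝ) ≤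
      polyPerim w n := by
  -- the height `s`
  obtain ⟨s, hs⟩ : ∃ s : ℝ, s = Real.sqrt (117 / 200) := ⟨_, rfl⟩
  have hs2 : s ^ 2 = 117 / 200 := by rw [hs, Real.sq_sqrt (by norm_num)]
  have hspos : 0 < s := by rw [hs]; positivity
  have hs34 : 3 / 4 ≤ s := by nlinarith [sq_nonneg (s + 3 / 4)]
  have hs1 : s ≤ 1 := by nlinarith [sq_nonneg (s + 1)]
  have hs21 : s ^ 2 < 1 := by rw [hs2]; norm_num
  have hsM : Real.sqrt (1 - 83 / 200) = s := by rw [hs]; norm_num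
  have hM1 : (83 / 200 : ℝ) < 1 := by norm_num
  -- (1) strict interior, (2) cap lines
  have hin₁' := orient3_pos_of_segments hn hper hcx hz₁ hM1 hin₁ hseg₁
  have hin₂' := orient3_pos_of_segments hn hper hcx hz₂ hM1 hin₂ hseg₂
  have hcap₁ : ∀ i, s * ‖cross3 (w i) (w (i + 1))‖ ≤ orient3 (w i) (w (i + 1)) z₁ := fun i => by
    rw [← hsM]; exact sqrt_mul_norm_cross3_le_orient3 hn hper hcx hz₁ (by norm_num) hM1 hin₁' hseg₁ i
  have hcap₂ : ∀ i, s * ‖cross3 (w i) (w (i + 1))‖ ≤ orient3 (w i) (w (i + 1)) z₂ := fun i => by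
    rw [← hsM]; exact sqrt_mul_norm_cross3_le_orient3 hn hper hcx hz₂ (by norm_num) hM1 hin₂' hseg₂ i
  -- (3) `z₂ ≠ −z₁`
  have hc1 : -1 < ⟪z₁, z₂⟫ := by
    by_contra hle
    rw [not_lt] at hle
    have hsum : ‖z₁ + z₂‖ ^ 2 = 2 + 2 * ⟪z₁, z₂⟫ := by rw [norm_add_sq_real, hz₁, hz₂]; ring
    have h0 : z₁ + z₂ = 0 := by
      have : ‖z₁ + z₂‖ ^ 2 ≤ 0 := by rw [hsum]; linarith
      have : ‖z₁ + z₂‖ = 0 := by nlinarith [norm_nonneg (z₁ + z₂)]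
      exact norm_eq_zero.1 this
    have hz : z₂ = (-1 : ℝ) • z₁ := by
      rw [neg_one_smul]; exact eq_neg_of_add_eq_zero_right h0
    have := hin₂' 0
    rw [hz, orient3_smul_right] at this
    linarith [hin₁' 0]
  -- (4) the sixty-degree point
  set y := sixtyPoint z₁ z₂ with hy
  have hy1 : ‖y‖ = 1 := norm_sixtyPoint hz₁ hz₂ hc1 h12
  have hzy : ⟪z₁, y⟫ = 1 / 2 := inner_sixtyPoint hz₁
  have hcapy : ∀ i, s * ‖cross3 (w i) (w (i + 1))‖ ≤ orient3 (w i) (w (i + 1)) y := fun i => by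
    rw [← inner_cross3_left]
    exact le_inner_sixtyPoint hc1 h12 (mul_nonneg hspos.le (norm_nonneg _))
      (by rw [inner_cross3_left]; exact hcap₁ i) (by rw [inner_cross3_left]; exact hcap₂ i)
  have hyK : ∀ i, 0 ≤ orient3 (w i) (w (i + 1)) y := fun i =>
    (mul_nonneg hspos.le (norm_nonneg _)).trans (hcapy i)
  -- (5) tangent normals
  set a := 2 * s / 3 with ha
  set b := Real.sqrt (22 / 75) with hb
  have hb2 : b ^ 2 = 22 / 75 := Real.sq_sqrt (by norm_num)
  have hbpos : 0 < b := Real.sqrt_pos.2 (by norm_num)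
  have ha32 : 3 * a / 2 = s := by rw [ha]; ring
  have hab : 3 * a ^ 2 + 3 / 4 * b ^ 2 = 1 := by rw [ha, hb2]; nlinarith [hs2]
  have hab' : 3 * a ^ 2 + 3 / 4 * (-b) ^ 2 = 1 := by rw [neg_sq]; exact hab
  set np := tangentNormal z₁ y a b with hnp
  set nm := tangentNormal z₁ y a (-b) with hnm
  have hnp1 : ‖np‖ = 1 := norm_tangentNormal hz₁ hy1 hzy hab
  have hnm1 : ‖nm‖ = 1 := norm_tangentNormal hz₁ hy1 hzy hab'
  have hpz : ⟪np, z₁⟫ = s := by rw [hnp, inner_tangentNormal_left hz₁ hzy, ha32]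
  have hpy : ⟪np, y⟫ = s := by rw [hnp, inner_tangentNormal_right hy1 hzy, ha32]
  have hmz : ⟪nm, z₁⟫ = s := by rw [hnm, inner_tangentNormal_left hz₁ hzy, ha32]
  have hmy : ⟪nm, y⟫ = s := by rw [hnm, inner_tangentNormal_right hy1 hzy, ha32]
  have hzp : ⟪z₁, np⟫ = s := by rw [real_inner_comm]; exact hpz
  have hyp : ⟪y, np⟫ = s := by rw [real_inner_comm]; exact hpy
  have hzm : ⟪z₁, nm⟫ = s := by rw [real_inner_comm]; exact hmz
  have hym : ⟪y, nm⟫ = s := by rw [real_inner_comm]; exact hmy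
  have hpm : ⟪np, nm⟫ = 3 * a ^ 2 + 3 / 4 * (b * -b) := by
    rw [hnp, hnm, inner_tangentNormal_tangentNormal hz₁ hy1 hzy]
  have hpm_lt : ⟪np, nm⟫ < 1 := by rw [hpm]; nlinarith [hab, hbpos]
  have hop : orient3 z₁ y np = 3 / 4 * b := by rw [hnp, orient3_tangentNormal hz₁ hy1 hzy]
  have hom : orient3 z₁ y nm = 3 / 4 * (-b) := by rw [hnm, orient3_tangentNormal hz₁ hy1 hzy]
  have hpp : ⟪np, np⟫ = 1 := by rw [real_inner_self_eq_norm_sq, hnp1, one_pow]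
  have hmm : ⟪nm, nm⟫ = 1 := by rw [real_inner_self_eq_norm_sq, hnm1, one_pow]
  have hnp0 : np ≠ 0 := ne_zero_of_norm_one hnp1
  have hnm0 : nm ≠ 0 := ne_zero_of_norm_one hnm1
  -- (6) tangent points
  set t₁ := tangentPoint z₁ np s with ht₁
  set t₂ := tangentPoint y np s with ht₂
  set t₁' := tangentPoint z₁ nm s with ht₁'
  set t₂' := tangentPoint y nm s with ht₂'
  have ht₁1 : ‖t₁‖ = 1 := norm_tangentPoint hz₁ hnp1 hpz hs21
  have ht₂1 : ‖t₂‖ = 1 := norm_tangentPoint hy1 hnp1 hpy hs21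
  have ht₁'1 : ‖t₁'‖ = 1 := norm_tangentPoint hz₁ hnm1 hmz hs21
  have ht₂'1 : ‖t₂'‖ = 1 := norm_tangentPoint hy1 hnm1 hmy hs21
  have ht₁p : ⟪t₁, np⟫ = 0 := inner_tangentPoint_normal hnp1 hpz
  have ht₂p : ⟪t₂, np⟫ = 0 := inner_tangentPoint_normal hnp1 hpy
  have ht₁'m : ⟪t₁', nm⟫ = 0 := inner_tangentPoint_normal hnm1 hmz
  have ht₂'m : ⟪t₂', nm⟫ = 0 := inner_tangentPoint_normal hnm1 hmy
  -- the other sign: `⟪t₁, nm⟫ > 0` etc.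
  have hc0 : 0 < 1 / Real.sqrt (1 - s ^ 2) := div_pos one_pos (Real.sqrt_pos.2 (sub_pos.2 hs21))
  have hcross : ∀ (z n n' : EuclideanSpace ℝ (Fin 3)), ⟪z, n'⟫ = s → ⟪n, n'⟫ < 1 →
      0 < ⟪tangentPoint z n s, n'⟫ := by
    intro z n n' hzn' hnn'
    rw [tangentPoint, real_inner_smul_left, inner_sub_left, real_inner_smul_left, hzn']
    apply mul_pos hc0
    rw [show s - s * ⟪n, n'⟫ = s * (1 - ⟪n, n'⟫) by ring]
    exact mul_pos hspos (sub_pos.2 hnn')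
  have hmp : ⟪nm, np⟫ < 1 := by rw [real_inner_comm]; exact hpm_lt
  have ht₁m : 0 < ⟪t₁, nm⟫ := hcross z₁ np nm hzm hpm_lt
  have ht₂m : 0 < ⟪t₂, nm⟫ := hcross y np nm hym hpm_lt
  have ht₁'p : 0 < ⟪t₁', np⟫ := hcross z₁ nm np hzp hmp
  have ht₂'p : 0 < ⟪t₂', np⟫ := hcross y nm np hyp hmp
  -- membership in the cone of `w`
  have hK : ∀ (z n : EuclideanSpace ℝ (Fin 3)), ‖n‖ = 1 →
      (∀ i, s * ‖cross3 (w i) (w (i + 1))‖ ≤ orient3 (w i) (w (i + 1)) z) →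
      ∀ i, 0 ≤ orient3 (w i) (w (i + 1)) (tangentPoint z n s) := by
    intro z n hn1 hc i
    rw [← inner_cross3_left]
    exact inner_tangentPoint_nonneg hn1 hspos.le hs21 (by rw [inner_cross3_left]; exact hc i)
  have ht₁K := hK z₁ np hnp1 hcap₁
  have ht₂K := hK y np hnp1 hcapy
  have ht₁'K := hK z₁ nm hnm1 hcap₁
  have ht₂'K := hK y nm hnm1 hcapy
  -- chords and sweeps
  have hT : angle t₁ t₂ = arccos (-17 / 83) := by
    have h := inner_tangentPoint_tangentPoint (z₁ := z₁) (z₂ := y) hnp1 hpz hpy hs21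
    show arccos _ = _
    rw [ht₁1, ht₂1, mul_one, div_one, h, tangent_chord_cos hzy hs2]
  have hT' : angle t₂' t₁' = arccos (-17 / 83) := by
    have h := inner_tangentPoint_tangentPoint (z₁ := y) (z₂ := z₁) hnm1 hmy hmz hs21
    show arccos _ = _
    rw [ht₂'1, ht₁'1, mul_one, div_one, h, real_inner_comm z₁ y, tangent_chord_cos hzy hs2]
  have hΨval : ∀ (z : EuclideanSpace ℝ (Fin 3)), ‖z‖ = 1 → ⟪z, np⟫ = s → ⟪z, nm⟫ = s →
      angle (perpTo z (tangentPoint z np s)) (perpTo z (tangentPoint z nm s)) = arccos (-5 / 83) := by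
    intro z hz h1 h2
    rw [angle_perpTo_tangentPoints hz hspos hs21]
    have hc := cos_angle_perpTo_normals hz hnp1 hnm1 h1 h2
    have h1s : (1 : ℝ) - s ^ 2 ≠ 0 := by rw [hs2]; norm_num
    have hcos : Real.cos (angle (perpTo z np) (perpTo z nm)) = -5 / 83 := by
      have h' : Real.cos (angle (perpTo z np) (perpTo z nm)) = (⟪np, nm⟫ - s ^ 2) / (1 - s ^ 2) := by
        rw [eq_div_iff h1s]; exact hc
      rw [h', hpm]; exact back_sweep_cos ha32 hab hs2
    rw [← hcos, arccos_cos (angle_nonneg _ _) (angle_le_pi _ _)]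
  have hΨ₁ := hΨval z₁ hz₁ hzp hzm
  have hΨ₂ := hΨval y hy1 hyp hym
  -- (7) two clipping steps
  obtain ⟨m₁, P, hm₁, hPper, hPcx, hPperim, hPsgn, hPinh, hPcone, hPcaps⟩ :=
    cut_step hn hper hcx np (y₀ := z₁) hin₁ (by rw [hzp]; exact hspos)
  have hz₁P : ∀ j, 0 ≤ orient3 (P j) (P (j + 1)) z₁ := hPcone z₁ hin₁ (by rw [hzp]; exact hspos.le)
  obtain ⟨m, v, hm, hvper, hvcx, hvperim, hvsgm, hvinh, hvcone, hvcaps⟩ :=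
    cut_step hm₁ hPper hPcx nm (y₀ := z₁) hz₁P (by rw [hzm]; exact hspos)
  have hvsgp : ∀ j, 0 ≤ ⟪v j, np⟫ := hvinh np hPsgn
  have hvK : ∀ x : EuclideanSpace ℝ (Fin 3), (∀ i, 0 ≤ orient3 (w i) (w (i + 1)) x) → 0 ≤ ⟪x, np⟫ →
      0 ≤ ⟪x, nm⟫ → ∀ j, 0 ≤ orient3 (v j) (v (j + 1)) x :=
    fun x hx hxp hxm => hvcone x (hPcone x hx hxp) hxm
  have hvt₁ := hvK t₁ ht₁K (by rw [ht₁p]) ht₁m.le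
  have hvt₂ := hvK t₂ ht₂K (by rw [ht₂p]) ht₂m.le
  have hvt₁' := hvK t₁' ht₁'K ht₁'p.le (by rw [ht₁'m])
  have hvt₂' := hvK t₂' ht₂'K ht₂'p.le (by rw [ht₂'m])
  have hvcap₁ : ∀ j, s * ‖cross3 (v j) (v (j + 1))‖ ≤ orient3 (v j) (v (j + 1)) z₁ :=
    hvcaps z₁ s (hPcaps z₁ s hcap₁ (by rw [hnp1, mul_one, hpz])) (by rw [hnm1, mul_one, hmz])
  have hvcapy : ∀ j, s * ‖cross3 (v j) (v (j + 1))‖ ≤ orient3 (v j) (v (j + 1)) y :=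
    hvcaps y s (hPcaps y s hcapy (by rw [hnp1, mul_one, hpy])) (by rw [hnm1, mul_one, hmy])
  have hperim : polyPerim v m ≤ polyPerim w n := hvperim.trans hPperim
  clear hvperim hPperim hvcaps hPcaps hvcone hPcone hvinh hPinh hPsgn hz₁P hPcx hPper hvK hK ht₁K ht₂K
    ht₁'K ht₂'K hcap₁ hcap₂ hcapy hyK hin₁' hin₂' hseg₁ hseg₂ hin₁ hin₂ hcx hper hΨval hcross
  -- (8) locate the chord `t₁ t₂` on an edge and rotate it to edge `0`
  have ht₁₂ : t₁ ≠ t₂ := by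
    intro h
    have h1 : ⟪t₁, t₂⟫ = 1 := by rw [← h, real_inner_self_eq_norm_sq, ht₁1, one_pow]
    have h2 := inner_tangentPoint_tangentPoint (z₁ := z₁) (z₂ := y) hnp1 hpz hpy hs21
    rw [tangent_chord_cos hzy hs2] at h2
    rw [h2] at h1; norm_num at h1
  obtain ⟨e, he0, he1, α₁, β₁, α₂, β₂, hα₁, hβ₁, hα₂, hβ₂, ht₁e, ht₂e⟩ :=
    locate_chord hm hvper hvcx hnp0 hvsgp ht₁1 ht₂1 ht₁₂ hvt₁ hvt₂ ht₁p ht₂p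
  obtain ⟨u, hu⟩ : ∃ u : ℕ → EuclideanSpace ℝ (Fin 3), ∀ i, u i = v (i + e) := ⟨_, fun _ => rfl⟩
  have hue : ∀ i, u (i + 1) = v (i + e + 1) := fun i => by rw [hu, show i + 1 + e = i + e + 1 by ring]
  have huper : ∀ i, u (i + m) = u i := fun i => by rw [hu, hu]; exact shift_periodic e hvper i
  have hucx : ∀ i j k, i < j → j < k → k < i + m → 0 < orient3 (u i) (u j) (u k) :=
    fun i j k h1 h2 h3 => by rw [hu, hu, hu]; exact shift_convex e hvcx i j k h1 h2 h3
  have hu0 : u 0 = v e := by rw [hu, zero_add]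
  have hu1 : u 1 = v (e + 1) := by rw [hu, add_comm]
  have hum : u m = u 0 := by rw [← huper 0, zero_add]
  have hune : ∀ t, u t ≠ 0 := ne_zero_of_convex hucx hm
  have huperim : polyPerim u m = polyPerim v m := by
    unfold polyPerim
    have : ∀ i, angle (u i) (u (i + 1)) = angle (v (i + e)) (v (i + e + 1)) := fun i => by rw [hue, hu]
    simp only [this]
    exact sum_period_shift e hvper (fun a b => angle a b)
  have husgp : ∀ j, 0 ≤ ⟪u j, np⟫ := fun j => by rw [hu]; exact hvsgp _
  have husgm : ∀ j, 0 ≤ ⟪u j, nm⟫ := fun j => by rw [hu]; exact hvsgm _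
  have huK : ∀ x, (∀ j, 0 ≤ orient3 (v j) (v (j + 1)) x) → ∀ j, 0 ≤ orient3 (u j) (u (j + 1)) x :=
    fun x hx j => by rw [hue, hu]; exact hx _
  have hucap₁ : ∀ j, s * ‖cross3 (u j) (u (j + 1))‖ ≤ orient3 (u j) (u (j + 1)) z₁ := fun j => by
    rw [hue, hu]; exact hvcap₁ _
  have hucapy : ∀ j, s * ‖cross3 (u j) (u (j + 1))‖ ≤ orient3 (u j) (u (j + 1)) y := fun j => by
    rw [hue, hu]; exact hvcapy _
  have hu0p : ⟪u 0, np⟫ = 0 := by rw [hu0]; exact he0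
  have hu1p : ⟪u 1, np⟫ = 0 := by rw [hu1]; exact he1
  have ht₁u : t₁ = α₁ • u 0 + β₁ • u 1 := by rw [hu0, hu1]; exact ht₁e
  have ht₂u : t₂ = α₂ • u 0 + β₂ • u 1 := by rw [hu0, hu1]; exact ht₂e
  -- (9) locate the chord `t₂' t₁'` on the rotated polygon
  have ht₂₁' : t₂' ≠ t₁' := by
    intro h
    have h1 : ⟪t₂', t₁'⟫ = 1 := by rw [h, real_inner_self_eq_norm_sq, ht₁'1, one_pow]
    have h2 := inner_tangentPoint_tangentPoint (z₁ := y) (z₂ := z₁) hnm1 hmy hmz hs21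
    rw [real_inner_comm z₁ y, tangent_chord_cos hzy hs2] at h2
    rw [h2] at h1; norm_num at h1
  obtain ⟨e', he'0, he'1, γ₁, δ₁, γ₂, δ₂, hγ₁, hδ₁, hγ₂, hδ₂, ht₂'e, ht₁'e⟩ :=
    locate_chord hm huper hucx hnm0 husgm ht₂'1 ht₁'1 ht₂₁' (huK t₂' hvt₂') (huK t₁' hvt₁') ht₂'m ht₁'m
  -- reduce `e'` modulo `m`
  set j₀ := e' % m with hj₀
  have hj₀m : j₀ < m := Nat.mod_lt _ (by omega)
  have huj₀ : u j₀ = u e' := by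
    conv_rhs => rw [← Nat.mod_add_div' e' m, periodic_add_mul huper]
  have huj₀1 : u (j₀ + 1) = u (e' + 1) := by
    conv_rhs => rw [show e' + 1 = (e' % m + 1) + e' / m * m by have := Nat.mod_add_div' e' m; omega,
      periodic_add_mul huper]
  have hj₀0 : ⟪u j₀, nm⟫ = 0 := by rw [huj₀]; exact he'0
  have hj₀1 : ⟪u (j₀ + 1), nm⟫ = 0 := by rw [huj₀1]; exact he'1
  have ht₂'u : t₂' = γ₁ • u j₀ + δ₁ • u (j₀ + 1) := by rw [huj₀, huj₀1]; exact ht₂'e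
  have ht₁'u : t₁' = γ₂ • u j₀ + δ₂ • u (j₀ + 1) := by rw [huj₀, huj₀1]; exact ht₁'e
  have hj₀1le : 1 ≤ j₀ := by
    by_contra h
    have h0 : j₀ = 0 := by omega
    have : ⟪t₁, nm⟫ = 0 := by
      rw [ht₁u, inner_add_left, real_inner_smul_left, real_inner_smul_left]
      rw [h0] at hj₀0 hj₀1
      rw [hj₀0, show (0:ℕ) + 1 = 1 from rfl] at *
      rw [hj₀1]; ring
    exact absurd this ht₁m.ne'
  -- (10) the ORDER of the chord points on their edges
  have hedge_pos : ∀ (j : ℕ) (nv zz : EuclideanSpace ℝ (Fin 3)), ⟪u j, nv⟫ = 0 → ⟪u (j + 1), nv⟫ = 0 →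
      ⟪zz, nv⟫ = s → ⟪nv, nv⟫ = 1 →
      (∀ j, s * ‖cross3 (u j) (u (j + 1))‖ ≤ orient3 (u j) (u (j + 1)) zz) →
      0 < orient3 (u j) (u (j + 1)) nv := by
    intro j nv zz h0 h1 hz hnn hcap
    have hne : cross3 (u j) (u (j + 1)) ≠ 0 :=
      cross3_ne_zero_of_orient3_ne_zero (hucx j (j + 1) (j + 2) (by omega) (by omega) (by omega)).ne'
    have hq : 0 < orient3 (u j) (u (j + 1)) zz :=
      lt_of_lt_of_le (mul_pos hspos (norm_pos_iff.2 hne)) (hcap j)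
    have h := orient3_edge_on_circle (q := zz) h0 h1 nv
    rw [hz, hnn, mul_one] at h
    have : 0 < orient3 (u j) (u (j + 1)) nv * s := by rw [h]; exact hq
    exact pos_of_mul_pos_left this hspos.le
  have hdetp : 0 < α₁ * β₂ - α₂ * β₁ := by
    have h1 := orient3_pair_expand ht₁u ht₂u np
    have h2 : orient3 t₁ t₂ np = (1 / Real.sqrt (1 - s ^ 2)) ^ 2 * orient3 z₁ y np :=
      orient3_tangentPoints z₁ y np s
    have h3 : 0 < orient3 t₁ t₂ np := by
      rw [h2, hop]; exact mul_pos (pow_pos hc0 2) (mul_pos (by norm_num) hbpos)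
    have h4 := hedge_pos 0 np z₁ hu0p hu1p hzp hpp hucap₁
    rw [h1] at h3
    exact lt_of_mul_lt_mul_right (by rw [zero_mul]; exact h3) h4.le
  have hdetm : 0 < γ₁ * δ₂ - γ₂ * δ₁ := by
    have h1 := orient3_pair_expand ht₂'u ht₁'u nm
    have h2 : orient3 t₂' t₁' nm = (1 / Real.sqrt (1 - s ^ 2)) ^ 2 * orient3 y z₁ nm :=
      orient3_tangentPoints y z₁ nm s
    have hyz : orient3 y z₁ nm = -orient3 z₁ y nm := orient3_swap_left _ _ _
    have h3 : 0 < orient3 t₂' t₁' nm := by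
      rw [h2, hyz, hom, show -(3 / 4 * -b) = 3 / 4 * b by ring]
      exact mul_pos (pow_pos hc0 2) (mul_pos (by norm_num) hbpos)
    have h4 := hedge_pos j₀ nm z₁ hj₀0 hj₀1 hzm hmm hucap₁
    rw [h1] at h3
    exact lt_of_mul_lt_mul_right (by rw [zero_mul]; exact h3) h4.le
  have ht₁0 : t₁ ≠ 0 := ne_zero_of_norm_one ht₁1
  have ht₂0 : t₂ ≠ 0 := ne_zero_of_norm_one ht₂1
  have ht₁'0 : t₁' ≠ 0 := ne_zero_of_norm_one ht₁'1
  have ht₂'0 : t₂' ≠ 0 := ne_zero_of_norm_one ht₂'1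
  have hsplitp := angle_split3 hα₁ hβ₁ hα₂ hβ₂ hdetp ht₁u ht₂u ht₁0 ht₂0
  have hsplitm := angle_split3 hγ₁ hδ₁ hγ₂ hδ₂ hdetm ht₂'u ht₁'u ht₂'0 ht₁'0
  -- (11) perimeter split and the two back paths
  have hps := polyPerim_split u hj₀1le hj₀m
  -- path 2 (around `y`): t₂, u 1, …, u j₀, t₂'
  have hpath₂ := path_bound hy1 hs34 hs1 (pathSeq t₂ u j₀ t₂') (j₀ + 1) (by omega)
    (by
      intro t ht
      rcases Nat.eq_zero_or_pos t with h | h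
      · rw [h, pathSeq_zero]; exact ht₂0
      rcases Nat.lt_or_ge j₀ t with h' | h'
      · rw [show t = j₀ + 1 by omega, pathSeq_last]; exact ht₂'0
      · rw [pathSeq_mid _ _ _ _ h h']; exact hune t)
    (by
      intro t ht
      rcases Nat.eq_zero_or_pos t with h | h
      · subst h
        refine ⟨np, hnp1, by rw [hyp], ?_, ?_⟩
        · rw [pathSeq_zero]; exact ht₂p
        · rw [show (0:ℕ) + 1 = 1 from rfl, pathSeq_mid _ _ _ _ le_rfl hj₀1le]; exact hu1p
      rcases Nat.lt_or_ge t j₀ with h' | h'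
      · rw [pathSeq_mid _ _ _ _ h h'.le, pathSeq_mid _ _ _ _ (by omega) h']
        have hne : cross3 (u t) (u (t + 1)) ≠ 0 :=
          cross3_ne_zero_of_orient3_ne_zero (hucx t (t + 1) (t + 2) (by omega) (by omega) (by omega)).ne'
        exact edge_normal_of_cap hne (hucapy t)
      · have ht' : t = j₀ := by omega
        subst ht'
        refine ⟨nm, hnm1, by rw [hym], ?_, ?_⟩
        · rw [pathSeq_mid _ _ _ _ h le_rfl]; exact hj₀0
        · rw [pathSeq_last]; exact ht₂'m)
  rw [pathSeq_zero, pathSeq_last, sum_pathSeq _ _ hj₀1le, hΨ₂] at hpath₂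
  -- path 1 (around `z₁`): t₁', u (j₀+1), …, u m = u 0, t₁
  have hmj : 1 ≤ m - j₀ := by omega
  have hpath₁ := path_bound hz₁ hs34 hs1 (pathSeq t₁' (fun t => u (j₀ + t)) (m - j₀) t₁) (m - j₀ + 1)
    (by omega)
    (by
      intro t ht
      rcases Nat.eq_zero_or_pos t with h | h
      · rw [h, pathSeq_zero]; exact ht₁'0
      rcases Nat.lt_or_ge (m - j₀) t with h' | h'
      · rw [show t = m - j₀ + 1 by omega, pathSeq_last]; exact ht₁0
      · rw [pathSeq_mid _ _ _ _ h h']; exact hune _)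
    (by
      intro t ht
      rcases Nat.eq_zero_or_pos t with h | h
      · subst h
        refine ⟨nm, hnm1, by rw [hzm], ?_, ?_⟩
        · rw [pathSeq_zero]; exact ht₁'m
        · rw [show (0:ℕ) + 1 = 1 from rfl, pathSeq_mid _ _ _ _ le_rfl hmj]; exact hj₀1
      rcases Nat.lt_or_ge t (m - j₀) with h' | h'
      · rw [pathSeq_mid _ _ _ _ h h'.le, pathSeq_mid _ _ _ _ (by omega) h']
        have hne : cross3 (u (j₀ + t)) (u (j₀ + (t + 1))) ≠ 0 := by
          rw [show j₀ + (t + 1) = j₀ + t + 1 by ring]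
          exact cross3_ne_zero_of_orient3_ne_zero
            (hucx (j₀ + t) (j₀ + t + 1) (j₀ + t + 2) (by omega) (by omega) (by omega)).ne'
        have := edge_normal_of_cap hne (by rw [show j₀ + (t + 1) = j₀ + t + 1 by ring]; exact hucap₁ (j₀ + t))
        exact this
      · have ht' : t = m - j₀ := by omega
        subst ht'
        refine ⟨np, hnp1, by rw [hzp], ?_, ?_⟩
        · rw [pathSeq_mid _ _ _ _ h le_rfl, show j₀ + (m - j₀) = m by omega, hum]; exact hu0p
        · rw [pathSeq_last]; exact ht₁p)
  have hΨ₁' : angle (perpTo z₁ t₁') (perpTo z₁ t₁) = arccos (-5 / 83) := by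
    rw [angle_comm]; exact hΨ₁
  rw [pathSeq_zero, pathSeq_last, sum_pathSeq _ _ hmj, hΨ₁', show j₀ + (m - j₀) = m by omega, hum]
    at hpath₁
  -- reindex the middle sum of path 1
  have hmid : ∑ t ∈ Ico 1 (m - j₀), angle (u (j₀ + t)) (u (j₀ + (t + 1))) =
      ∑ j ∈ Ico (j₀ + 1) m, angle (u j) (u (j + 1)) := by
    have h := Finset.sum_Ico_add' (fun j => angle (u j) (u (j + 1))) 1 (m - j₀) j₀
    rw [show 1 + j₀ = j₀ + 1 by ring, show m - j₀ + j₀ = m by omega] at h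
    rw [← h]
    apply Finset.sum_congr rfl
    intro t _
    rw [show j₀ + t = t + j₀ by ring, show j₀ + (t + 1) = t + j₀ + 1 by ring]
  rw [hmid, show j₀ + 1 = j₀ + 1 from rfl] at hpath₁
  -- (12) assemble
  have hsy : s * 1000 / 1001 * arccos (-5 / 83 : ℝ) ≤
      angle t₂ (u 1) + ∑ t ∈ Ico 1 j₀, angle (u t) (u (t + 1)) + angle (u j₀) t₂' := by
    linarith only [hpath₂]
  have hsz : s * 1000 / 1001 * arccos (-5 / 83 : ℝ) ≤
      angle t₁' (u (j₀ + 1)) + ∑ j ∈ Ico (j₀ + 1) m, angle (u j) (u (j + 1)) + angle (u 0) t₁ := by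
    linarith only [hpath₁]
  rw [← hs]
  calc 2 * arccos (-17 / 83 : ℝ) + 2 * (s * 1000 / 1001) * arccos (-5 / 83 : ℝ)
      ≤ polyPerim u m := by
        rw [hps, hsplitp, hsplitm, hT, hT']
        linarith only [hsy, hsz]
    _ = polyPerim v m := huperim
    _ ≤ polyPerim w n := hperim

end Summit.Ventures.Crystal3D

end
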